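import Summits.QuantumFields.YangMills.Theorems.BalabanUVNodesN26TransportGeneric
import Summits.QuantumFields.YangMills.Theorems.BalabanUVNodesN26AtRecord12KappaSufficient
import Summits.QuantumFields.YangMills.Theorems.BalabanUVNodesN28AtBetaOfRecord
import Literature.MathematicalPhysics.QuantumFieldTheory.Balaban1983to89.Node00.Record13

/-!
# DAG node N26 — B4 «β-continuity» AT THE STAGE-13 RECORD (`Node00.datumOfRecord₁₃`, `Node00.IsRecordOfRecord₁₃C`): what B4 IS at the Stage-13 β of record
# (the MERGED β over the CANONICAL-VERSION transport `TcanOfRecord` and the (2.9) species `chiFixed29 θ.ν θ.ε₂₉`), N26 from the rows-(D4) ∧ B4 residue ∕ the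
# (D4)-chain ∕ the (D4) socket inputs for THAT merged family, «N26 closes WITH N25» at ₁₃, the record-level ∀-faces, and N1's κ rows at `θ.toStage12Params`

Cell `pub-ymgap`, YM-PLAN Track A (HUMAN RULING D-0062), seat `pub-ymgap-dag-n26-c` gen 5 (drafted) ∕ gen 6 (filed; R134 acceleration seat, s2); helper for crux K2‴
`EndpointGivenBR13` (stmt-QuantumFields-19911, route `BalabanUVNodes` rev 16 — the ₁₂ text re-keyed `datumOfRecord₁₂ ↦ datumOfRecord₁₃`).  Director-ym LINES №125 «RECORD 13» ∕ №128 ∕ №132; node00-def-T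
g7's `Node00/Record13.lean` (`Stage13Params extends Stage12Params` by ONE numeric letter, the (2.9) threshold; `betaOfRecord₁₃ θ := betaOfRecord₈Tχ (TcanOfRecord) (chiFixed29 θ.ν ·)
θ.toStage8Params`, a NEW β-species — canonical-version transport, (2.9) small-field function; `βfun_datumOfRecord₁₃` `rfl`; `IsRecordOfRecord₁₃C`).  THE FIRST N26 FACE AT RECORD 13:
this seat's ₁₂ twin `…N26AtRecord12` (p461633) §1 ∕ §2 ∕ §4 re-keyed ₁₂ ↦ ₁₃ BY NAME (no Stage-11 «view» at ₁₃: the datum's β IS `betaOfRecord₁₃ θ`), the species-GENERIC engine of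
the n26-a lineage (`…N26TransportGeneric` §1: N26 over ANY transport `T` and χ-slot `χ` at a Stage-8 tuple) at `(TcanOfRecord, chiFixed29 θ.ν ·)`, the family road (p478229 §1)
re-keyed with the (1.22) identification at the ₁₃ merged β, and this seat's κ rows (p485881) read at `θ.toStage12Params`.

WHAT IS HERE (0 `def`, 0 `sorry`; compositions BY NAME).
§0 `betaOfRecord₁₃_eq_betaT` (the ₁₃ β IS `betaOfMerged (β_merged₁₃) (beta0OfMerged β_merged₁₃ θ.v₀) θ.γ` with
`β_merged₁₃ := betaMerged F (mergedTermFamilyMatT F N (TcanOfRecord F N) (chiFixed29 F N θ.ν θ.ε₂₉) θ.εbg) θ.ρ8 θ.bV`, `rfl`), `betaContH_betaOfRecord₁₃_iff`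
(WHAT B4 IS at ₁₃: per-`k` history-continuity of `β_merged₁₃ k` on `]0, γc]^{k+1}`, `γc ≤ θ.γ`), `oneLoopSplit_betaOfRecord₁₃_eq` ∕ `β0_split_betaOfRecord₁₃_eq` (EVERY split of the ₁₃ β is
`oneLoopSplit_betaOfMerged …`, its one-loop field `beta0OfMerged β_merged₁₃ θ.v₀` — what every NODE-O pin at ₁₃ speaks about).
§1 AT THE ₁₃ DATUM: `n26_datumOfRecord₁₃_of_atSlopeCont` (rows-(D4) ∧ B4 residue at any split, any slope), `betaContH_betaOfRecord₁₃_of_localizedRep` ∕ `n26_datumOfRecord₁₃_of_localizedRep` (the (D4) SOCKET inputs for the ₁₃ merged family — one-loop kernels `P0` with (5.10),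
leaf kernels `A1`, the split `hrep` of the ₁₃ merged limit kernel, leaves, N1–N3, (C-pt) — `n26lit_betaT_of_localizedRep` BY NAME), `endpoint_and_n26_datumOfRecord₁₃_of_residue_atSlopeCont`
(«N26 closes WITH N25» at ₁₃: row (D1)'s residue pinned on a split's one-loop field + `AtSlopeCont` ⟹ `EndpointExistence D.C.toB12 ∧ ∃ γc > 0, BetaContH γc D.βfun`).
§1b THE FAMILY CURRENCY AT ₁₃ (p478229 §1 re-keyed): the generic merged-split algebra `beta1_eq_oneLoopSplit_betaOfMerged_of_merged`; from a Stage-12 [B13] family of record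
`lamF : ResidB13Fam₁₂ F N θ.toStage12Params` AT FIXED HISTORY with the (1.22) identification `hm` AT THE ₁₃ MERGED β, the letters of record `c13OfRecord₁₂ θ.toStage12Params c₀`, N10's
family leaf, run sequences, laws, seams, (190) ∕ (1.7) data: `exists_chainTFac190H_betaOfRecord₁₃_of_family` (the instance at the ₁₃ split, handles on `A1`, tori, one-step data),
`atSlopeCont_betaOfRecord₁₃_of_family_leafwise` (rows-(D4) ∧ B4 residue at the ₁₃ split — the shape a ₁₃ crux stub would read), `betaContH_betaOfRecord₁₃_of_family`,
`n26_datumOfRecord₁₃_of_family`.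
§2 RECORD LEVEL over `IsRecordOfRecord₁₃C`: `n26_of_isRecordOfRecord₁₃C_of_atSlopeCont`, `endpoint_and_n26_of_isRecordOfRecord₁₃C_of_residue_atSlopeCont` (per admissible presentation,
on the world's own window).
§3 N1 AT THE FAITHFUL ₁₃ LETTERS `c13OfRecord₁₂ θ.toStage12Params { c₀ with ε₁ := θ.ε₂₉ }` ([II]'s threshold = the record's (2.9) letter, dag-ref-D PRINT-CHECK-EPS1):
`c13OfRecord₁₂_faithful_eq` (rfl), `condsL_faithful_stage13_iff_of_kappa_ge` (κ rows paid by `20·(64·log 162 + 1) ≤ θ.s2.lf.κ` as at ₁₂, p485881; left: THE RECORD's κ–ε₁ SMALL ROW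
`C₃·θ.ε₂₉·e^{5κ+1}·K₀(64,8)·576 ≤ 1` + the residual O(1)), `small_faithful_stage13_iff_eps_le` (the inequality a ₁₃ witness's `ε₁` must meet).

HONEST FRAMING.  Count-neutral knit; nothing of Bałaban's is constructed or estimated.  (D4) INSTANCE 0∕1 at ₁₃ exactly as at ₁₂ (the ₁₃ β is a NEW species; no ₁₂ β-side
instance exists to transfer); every (D1) ∕ (D4) ∕ socket ∕ family input is a displayed HYPOTHESIS on the record's residual objects; N25 ∕ N26 NOT discharged; counts unmoved.  The ₁₃
crux text K2‴ is not proved here (no registered ₁₃ stub is read; §1 ∕ §1b ∕ §2 are reductions of its (D4) ∕ N26 side to displayed inputs).  §1b ∕ §2 quantify over ALL residual letters `c₀`; the FAITHFUL letters read [II]'s `ε₁` from the record (§3, `c₀ := { c₀ with ε₁ := θ.ε₂₉ }`),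
where N1's small row is a RECORD inequality coupling `ε₁` to `κ` (dag-ref-D PRINT-CHECK-EPS1 ∕ ⚑ EPS-PIN; this seat's LOCATED-N26-EPS1) — displayed, never discharged here.
One finite four-torus programme at fixed ε per run — NOT the continuum limit, NOT ℝ⁴, NOT OS, NOT a mass gap, NOT Clay.
Sources (context): [I] = [Balaban1987RG1] CMP **109** (1987): Thm 2 p. 259, (0.13) p. 254, (1.7) p. 261, (1.20)–(1.22) p. 264, (2.9) p. 266, (2.12)–(2.14) p. 268, (5.10) p. 293;
[II] = [Balaban1988RG2Cluster] CMP **116** (1988): Lemma 3 (2.38) p. 20, p. 21; [Balaban1989LargeFieldII] CMP **122** (1989): Thm 1 p. 355 (the record).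
-/

noncomputable section

open scoped Matrix.Norms.L2Operator

namespace Summit.QuantumFields.YangMills.Theorems.BalabanUVNodesN26AtRecord13

open Literature.MathematicalPhysics.QuantumFieldTheory.Balaban1983to89
open Literature.MathematicalPhysics.QuantumFieldTheory.Balaban1983to89.FlowStep
open Literature.MathematicalPhysics.QuantumFieldTheory.Balaban1983to89.DagBinding (EndpointExistence WorldP)
open Literature.MathematicalPhysics.QuantumFieldTheory.Balaban1983to89.T4Continuum (T4Family FiniteEpsData)
open Literature.MathematicalPhysics.QuantumFieldTheory.Balaban1983to89.Node00
open Literature.MathematicalPhysics.QuantumFieldTheory.Balaban1983to89.B13ScaleTransfer (Pt)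
open Literature.MathematicalPhysics.QuantumFieldTheory.Balaban1983to89.B12TreeDecay (K₀)
open Literature.MathematicalPhysics.QuantumFieldTheory.Balaban1983to89.Beta.RemainderChainLattice
open Literature.MathematicalPhysics.QuantumFieldTheory.Balaban1983to89.TreeLengthTorus (TDom proj)
open Literature.MathematicalPhysics.QuantumFieldTheory.Balaban1983to89.B12Decay510 (mixedDeriv)
open Literature.MathematicalPhysics.QuantumFieldTheory.Balaban1983to89.Beta.RemainderLimitTorus (LDom limKernel tproj)
open Literature.MathematicalPhysics.QuantumFieldTheory.Balaban1983to89.Beta.RemainderWOfRecordB13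
open Literature.MathematicalPhysics.QuantumFieldTheory.Balaban1983to89.Beta.RemainderDecay190
open Literature.MathematicalPhysics.QuantumFieldTheory.Balaban1983to89.Beta.RemainderLocalityHolo (PolLeavesTFac190H)
open Literature.MathematicalPhysics.QuantumFieldTheory.Balaban1983to89.Beta.RemainderDecay190HoloChain (ChainTFac190H)
open Literature.MathematicalPhysics.QuantumFieldTheory.Balaban1983to89.Beta.OneStepKernelFamily (TbalOf)
open Literature.MathematicalPhysics.QuantumFieldTheory.Balaban1983to89.Beta.OneStepResolventKernel (JetData)
open Summit.QuantumFields.BalabanUV.Gaps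
open Summit.QuantumFields.BalabanUV.Gaps.BetaContFromD4Chain
open Summit.QuantumFields.YangMills.BalabanUVNodes.N28AtBetaOfRecord (oneLoopSplit_unique)
open Summit.QuantumFields.YangMills.Theorems.BalabanUVNodesN26TransportGeneric (betaContH_betaT_iff betaContH_betaT_of_localizedRep n26lit_betaT_of_localizedRep)
open Summit.QuantumFields.YangMills.Theorems.BalabanUVNodesN26AtRecord12B13Family (r22gen_half_c13OfRecord₁₂ c13OfRecord_member_of_family b13LeafOfRecord_member_of_family)
open Summit.QuantumFields.YangMills.Theorems.BalabanUVNodesN26CPtLeafwise (atSlopeCont_of_chainTFac190H_leafwise)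
open Summit.QuantumFields.YangMills.Theorems.BalabanUVNodesN26AtRecord12KappaSufficient
  (condsL_c13OfRecord₁₂_half_iff_of_kappa_ge small_c13OfRecord₁₂_iff_eps_le)
open Metric
open Filter Topology

variable (F : T4Family) (N : ℕ) [NeZero N]

/-! ## §0 What the Stage-13 β, its splits and B4 ARE -/

section Bridges

/-- **The Stage-13 β of record IS the merged-β split shape over `(TcanOfRecord, chiFixed29 θ.ν θ.ε₂₉)` at the Stage-8 part** (`rfl`: `betaOfRecord₈Tχ`'s body).
[cite: Balaban1987RG1, (1.20)-(1.22) p.264, (2.9) p.266 and (0.13) p.254 (bookkeeping)] -/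
theorem betaOfRecord₁₃_eq_betaT (θ : Stage13Params F N) :
    betaOfRecord₁₃ F N θ =
      letI := θ.instVβ₁; letI := θ.instVβ₂; letI := θ.instιβ
      betaOfMerged (betaMerged F (mergedTermFamilyMatT F N (TcanOfRecord F N) (chiFixed29 F N θ.ν θ.ε₂₉) θ.εbg) θ.ρ8 θ.bV)
        (beta0OfMerged (betaMerged F (mergedTermFamilyMatT F N (TcanOfRecord F N) (chiFixed29 F N θ.ν θ.ε₂₉) θ.εbg) θ.ρ8 θ.bV) θ.v₀) θ.γ :=
  rfl

/-- **WHAT B4 IS AT THE STAGE-13 β OF RECORD**: on a box `γc ≤ θ.γ`, per-`k` history-continuity on `]0, γc]^{k+1}` of the Stage-13 MERGED β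
`betaMerged F (mergedTermFamilyMatT F N (TcanOfRecord F N) (chiFixed29 F N θ.ν θ.ε₂₉) θ.εbg) θ.ρ8 θ.bV k` (n26-a's generic `betaContH_betaT_iff` BY NAME).
[cite: Balaban1987RG1, (1.20)-(1.22) p.264, (2.9) p.266 and (0.13) p.254] -/
theorem betaContH_betaOfRecord₁₃_iff (θ : Stage13Params F N) {γc : ℝ} (hle : γc ≤ θ.γ) :
    BetaContH γc (betaOfRecord₁₃ F N θ) ↔
      letI := θ.instVβ₁; letI := θ.instVβ₂; letI := θ.instιβ
      ∀ k, ContinuousOn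
        (betaMerged F (mergedTermFamilyMatT F N (TcanOfRecord F N) (chiFixed29 F N θ.ν θ.ε₂₉) θ.εbg) θ.ρ8 θ.bV k) (Box γc k) :=
  betaContH_betaT_iff F N (TcanOfRecord F N) (chiFixed29 F N θ.ν θ.ε₂₉) θ.toStage8Params hle

/-- **EVERY SPLIT OF THE STAGE-13 β IS the merged-β split** `oneLoopSplit_betaOfMerged (β_merged₁₃) (beta0OfMerged β_merged₁₃ θ.v₀) θ.γ` (`oneLoopSplit_unique`).
[cite: Balaban1987RG1, (2.12)-(2.14) p.268] -/
theorem oneLoopSplit_betaOfRecord₁₃_eq (θ : Stage13Params F N) (Sβ : B12Beta.OneLoopSplit (betaOfRecord₁₃ F N θ)) :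
    Sβ =
      letI := θ.instVβ₁; letI := θ.instVβ₂; letI := θ.instιβ
      oneLoopSplit_betaOfMerged
        (betaMerged F (mergedTermFamilyMatT F N (TcanOfRecord F N) (chiFixed29 F N θ.ν θ.ε₂₉) θ.εbg) θ.ρ8 θ.bV)
        (beta0OfMerged (betaMerged F (mergedTermFamilyMatT F N (TcanOfRecord F N) (chiFixed29 F N θ.ν θ.ε₂₉) θ.εbg) θ.ρ8 θ.bV) θ.v₀) θ.γ :=
  oneLoopSplit_unique _ _

/-- … so its one-loop field IS the Stage-13 one-loop number `beta0OfMerged β_merged₁₃ θ.v₀` (what every NODE-O ∕ (D1) pin at ₁₃ speaks about). [cite: Balaban1987RG1, (2.12)-(2.14) p.268] -/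
theorem β0_split_betaOfRecord₁₃_eq (θ : Stage13Params F N) (Sβ : B12Beta.OneLoopSplit (betaOfRecord₁₃ F N θ)) :
    Sβ.β0 =
      letI := θ.instVβ₁; letI := θ.instVβ₂; letI := θ.instιβ
      beta0OfMerged (betaMerged F (mergedTermFamilyMatT F N (TcanOfRecord F N) (chiFixed29 F N θ.ν θ.ε₂₉) θ.εbg) θ.ρ8 θ.bV) θ.v₀ := by
  have hS := oneLoopSplit_betaOfRecord₁₃_eq F N θ Sβ
  subst hS
  rfl

end Bridges

/-! ## §1 N26 at the Stage-13 datum in residue ∕ chain ∕ socket currency; «N26 closes WITH N25» at ₁₃ -/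

section AtDatum

/-- **N26 AT THE STAGE-13 DATUM FROM THE ROWS-(D4) ∧ B4 RESIDUE** at ANY split of the datum's β on a box `0 < γ₀`, any slope (`Gaps.BetaContFromD4Chain.betaContH_of_atSlopeCont`).
A located hypothesis of NODE O at the ₁₃ β; instance 0∕1. [cite: Balaban1988RG2Cluster, Lemma 3 (2.38) p.20; Balaban1987RG1, (1.20)-(1.22) p.264 and (5.10) p.293] -/
theorem n26_datumOfRecord₁₃_of_atSlopeCont (θ : Stage13Params F N) (hP : θ.Provisos₁₃ F N) {γ₀ : ℝ} (hγ₀ : 0 < γ₀)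
    {Sβ : B12Beta.OneLoopSplit (datumOfRecord₁₃ F N θ hP).βfun} {s : ℝ} (h : AtSlopeCont Sβ γ₀ s) :
    ∃ γc : ℝ, 0 < γc ∧ BetaContH γc (datumOfRecord₁₃ F N θ hP).βfun :=
  ⟨γ₀, hγ₀, betaContH_of_atSlopeCont h⟩

/-- **B4 ON THE BOX `γ₀ ≤ θ.γ` AT THE STAGE-13 β FROM THE (D4) SOCKET INPUTS FOR THE ₁₃ MERGED FAMILY** over `(TcanOfRecord, chiFixed29 θ.ν θ.ε₂₉)`: one-loop kernels `P0` with
`hβ0 : beta0OfMerged … θ.v₀ k = Σ_z P0 k z · z₀z₁`, per-scale (5.10) `hP0`, leaf kernels `A1`, the split `hrep` of the merged limit kernel, the leaves `hleaves`, N1–N3, (C-pt)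
(n26-a's generic `betaContH_betaT_of_localizedRep` BY NAME).  Every input a located hypothesis of NODE O; instance 0∕1.
[cite: Balaban1987RG1, (0.13) p.254, (1.7) p.261, (1.20)-(1.22) p.264, (2.9) p.266 and (5.10) p.293; Balaban1988RG2Cluster, Lemma 3 (2.38) p.20] -/
theorem betaContH_betaOfRecord₁₃_of_localizedRep (θ : Stage13Params F N) {γ₀ : ℝ} (hle : γ₀ ≤ θ.γ) {M : ℕ} [NeZero M]
    {c : B13.Consts} {ℓ α₂ : ℝ} {q : Consts190} (P0 : ℕ → Pt 4 → ℝ)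
    (hβ0 : letI := θ.instVβ₁; letI := θ.instVβ₂; letI := θ.instιβ
      ∀ k, beta0OfMerged (betaMerged F (mergedTermFamilyMatT F N (TcanOfRecord F N) (chiFixed29 F N θ.ν θ.ε₂₉) θ.εbg) θ.ρ8 θ.bV) θ.v₀ k =
        B12Beta.secondMoment (fun _ _ => P0 k) 0 1)
    (hP0 : ∀ k, ∃ C δ₁ : ℝ, 0 < δ₁ ∧ B12Sec2to5.Decay510 (P0 k) C δ₁)
    (A1 : (k : ℕ) → (Fin (k + 1) → ℝ) → LDom 4 → Pt 4 → ℝ)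
    (hrep : letI := θ.instVβ₁; letI := θ.instVβ₂; letI := θ.instιβ
      ∀ k (p : Fin (k + 1) → ℝ), p ∈ Box γ₀ k → ∀ z : Pt 4,
        polLimit F (k + 1) (fun K => mergedTermFamilyMatT F N (TcanOfRecord F N) (chiFixed29 F N θ.ν θ.ε₂₉) θ.εbg k p K) θ.ρ8 θ.bV 0 1 z =
          P0 k z + limKernel (A1 k p) z)
    (hleaves : ∀ k (p : Fin (k + 1) → ℝ), p ∈ Box γ₀ k → PolLeavesTFac190H 4 M (A1 k p) c ℓ α₂ q)
    (hC : CondsL 4 c ℓ) (h22 : c.R22gen ℓ) (hq : q.Valid c.δ₀) (hs : SignsL c α₂ q.B₃)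
    (hcont : letI := θ.instVβ₁; letI := θ.instVβ₂; letI := θ.instιβ
      ∀ k (z : Pt 4), ContinuousOn (fun p : Fin (k + 1) → ℝ =>
        polLimit F (k + 1) (fun K => mergedTermFamilyMatT F N (TcanOfRecord F N) (chiFixed29 F N θ.ν θ.ε₂₉) θ.εbg k p K) θ.ρ8 θ.bV 0 1 z) (Box γ₀ k)) :
    BetaContH γ₀ (betaOfRecord₁₃ F N θ) :=
  betaContH_betaT_of_localizedRep F N (TcanOfRecord F N) (chiFixed29 F N θ.ν θ.ε₂₉) θ.toStage8Params hle P0 hβ0 hP0 A1 hrep hleaves hC h22 hq hs hcont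

/-- **N26 AT THE STAGE-13 DATUM FROM THE (D4) SOCKET INPUTS** for the ₁₃ merged family on a box `0 < γ₀ ≤ θ.γ` (n26-a's generic `n26lit_betaT_of_localizedRep` BY NAME, read
through `βfun_datumOfRecord₁₃`).  Every input a located hypothesis of NODE O; instance 0∕1; N26 NOT discharged.
[cite: Balaban1987RG1, (0.13) p.254, (1.7) p.261, (1.20)-(1.22) p.264, (2.9) p.266 and (5.10) p.293; Balaban1988RG2Cluster, Lemma 3 (2.38) p.20] -/
theorem n26_datumOfRecord₁₃_of_localizedRep (θ : Stage13Params F N) (hP : θ.Provisos₁₃ F N) {γ₀ : ℝ} (hγ₀ : 0 < γ₀) (hle : γ₀ ≤ θ.γ)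
    {M : ℕ} [NeZero M] {c : B13.Consts} {ℓ α₂ : ℝ} {q : Consts190} (P0 : ℕ → Pt 4 → ℝ)
    (hβ0 : letI := θ.instVβ₁; letI := θ.instVβ₂; letI := θ.instιβ
      ∀ k, beta0OfMerged (betaMerged F (mergedTermFamilyMatT F N (TcanOfRecord F N) (chiFixed29 F N θ.ν θ.ε₂₉) θ.εbg) θ.ρ8 θ.bV) θ.v₀ k =
        B12Beta.secondMoment (fun _ _ => P0 k) 0 1)
    (hP0 : ∀ k, ∃ C δ₁ : ℝ, 0 < δ₁ ∧ B12Sec2to5.Decay510 (P0 k) C δ₁)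
    (A1 : (k : ℕ) → (Fin (k + 1) → ℝ) → LDom 4 → Pt 4 → ℝ)
    (hrep : letI := θ.instVβ₁; letI := θ.instVβ₂; letI := θ.instιβ
      ∀ k (p : Fin (k + 1) → ℝ), p ∈ Box γ₀ k → ∀ z : Pt 4,
        polLimit F (k + 1) (fun K => mergedTermFamilyMatT F N (TcanOfRecord F N) (chiFixed29 F N θ.ν θ.ε₂₉) θ.εbg k p K) θ.ρ8 θ.bV 0 1 z =
          P0 k z + limKernel (A1 k p) z)
    (hleaves : ∀ k (p : Fin (k + 1) → ℝ), p ∈ Box γ₀ k → PolLeavesTFac190H 4 M (A1 k p) c ℓ α₂ q)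
    (hC : CondsL 4 c ℓ) (h22 : c.R22gen ℓ) (hq : q.Valid c.δ₀) (hs : SignsL c α₂ q.B₃)
    (hcont : letI := θ.instVβ₁; letI := θ.instVβ₂; letI := θ.instιβ
      ∀ k (z : Pt 4), ContinuousOn (fun p : Fin (k + 1) → ℝ =>
        polLimit F (k + 1) (fun K => mergedTermFamilyMatT F N (TcanOfRecord F N) (chiFixed29 F N θ.ν θ.ε₂₉) θ.εbg k p K) θ.ρ8 θ.bV 0 1 z) (Box γ₀ k)) :
    ∃ γc : ℝ, 0 < γc ∧ BetaContH γc (datumOfRecord₁₃ F N θ hP).βfun := by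
  rw [βfun_datumOfRecord₁₃]
  exact n26lit_betaT_of_localizedRep F N (TcanOfRecord F N) (chiFixed29 F N θ.ν θ.ε₂₉) θ.toStage8Params hγ₀ hle P0 hβ0 hP0 A1 hrep
    hleaves hC h22 hq hs hcont

/-- **N25's END ∧ N26 AT THE STAGE-13 DATUM**: row (D1)'s residue `Gaps.D1Residue.Residue Lc Js Nc μ ν` pinned on the one-loop field of a split `Sβ` of the datum's β (= the ₁₃
one-loop number `beta0OfMerged β_merged₁₃ θ.v₀`, §0), and the rows-(D4) ∧ B4 residue `AtSlopeCont Sβ γ₀ (stepBal Nc Lc)` on a box `0 < γ₀` ⟹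
`EndpointExistence D.C.toB12 ∧ ∃ γc > 0, BetaContH γc D.βfun` at `D := datumOfRecord₁₃ θ hP` (`Gaps.BetaContFromD4Chain.endpointExistence_of_residue_atSlopeCont` at the datum's own
`fwd`).  Instance 0∕1 on both predicates; N25 ∕ N26 NOT discharged. [cite: Balaban1987RG1, Thm 2 p.259 (first sentence), (1.20)-(1.22) p.264 and (2.12)-(2.14) p.268; Balaban1988RG2Cluster, Lemma 3 (2.38) p.20] -/
theorem endpoint_and_n26_datumOfRecord₁₃_of_residue_atSlopeCont (θ : Stage13Params F N) (hP : θ.Provisos₁₃ F N)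
    (Sβ : B12Beta.OneLoopSplit (datumOfRecord₁₃ F N θ hP).βfun) {Lc : ℕ} [NeZero Lc] (Js : ℕ → JetData 3 Lc) {Nc : ℝ} {μ ν : Fin 4}
    (hβ : ∀ j, Sβ.β0 j = B12Beta.secondMoment (TbalOf Lc Js j) μ ν) (h1 : D1Residue.Residue Lc Js Nc μ ν) {γ₀ : ℝ} (hγ₀ : 0 < γ₀)
    (hres : AtSlopeCont Sβ γ₀ (B12Normalization.stepBal Nc Lc)) :
    EndpointExistence (datumOfRecord₁₃ F N θ hP).C.toB12 ∧ ∃ γc : ℝ, 0 < γc ∧ BetaContH γc (datumOfRecord₁₃ F N θ hP).βfun :=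
  ⟨endpointExistence_of_residue_atSlopeCont (datumOfRecord₁₃ F N θ hP).fwd Sβ Js hβ h1 hγ₀ hres, γ₀, hγ₀, betaContH_of_atSlopeCont hres⟩

end AtDatum

/-! ## §1b The generic merged-split algebra, and THE FAMILY CURRENCY AT ₁₃: the (D4) chain for the ₁₃ split from a Stage-12 [B13] family of record AT FIXED HISTORY (p478229 §1
re-keyed ₁₂ ↦ ₁₃: the (1.22) identification now at the ₁₃ merged β; letters, leaf, laws, seams, (190) ∕ (1.7) data verbatim at `θ.toStage12Params`) -/

section MergedSplit

/-- **The remainder field of the merged-β split IS the second moment of the leaf kernels' limit kernel on the box**, given the (1.22) identification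
`β_merged k p = β⁰ k + Σ_z (Σ'_Y A¹(p; Y, z)) z_μ z_ν` on a box `γ₀ ≤ γ` (generic form of p457986's `beta1_eq_oneLoopSplitOfRecord₁₁_of_merged`: the indicator algebra of
`oneLoopSplit_betaOfMerged`, species-blind). [cite: Balaban1987RG1, (1.22) p.264 and (2.12)-(2.14) p.268] -/
theorem beta1_eq_oneLoopSplit_betaOfMerged_of_merged (βm : HBeta) (β0 : ℕ → ℝ) {γ γ₀ : ℝ} (hle : γ₀ ≤ γ) {μ ν : Fin 4}
    (A1 : (k : ℕ) → (Fin (k + 1) → ℝ) → LDom 4 → Pt 4 → ℝ)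
    (hm : ∀ k (p : Fin (k + 1) → ℝ), p ∈ Box γ₀ k → βm k p = β0 k + B12Beta.secondMoment (fun _ _ => limKernel (A1 k p)) μ ν) :
    ∀ k (p : Fin (k + 1) → ℝ), p ∈ B12Beta.HistBox γ₀ k →
      (oneLoopSplit_betaOfMerged βm β0 γ).β1 k p = B12Beta.secondMoment (fun _ _ => limKernel (A1 k p)) μ ν := by
  intro k p hp
  have hp' : p ∈ Box γ₀ k := (histBox_eq_box γ₀ k) ▸ hp
  show (Box γ k).indicator (fun w => βm k w - β0 k) p = _
  rw [Set.indicator_of_mem (box_mono hle k hp'), hm k p hp']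
  ring

end MergedSplit

section Family13

variable {γ₀ : ℝ} {M : ℕ} [NeZero M] {μ ν : Fin 4} {α₂ : ℝ} {q : Consts190}
variable (θ : Stage13Params F N) (c₀ : B13.Consts) (lamF : ResidB13Fam₁₂ F N θ.toStage12Params) (hle : γ₀ ≤ θ.γ)
  -- the leaf kernels and the (1.22) identification AT THE STAGE-13 MERGED β (canonical transport, (2.9) species) on the box
  (A1 : (k : ℕ) → (Fin (k + 1) → ℝ) → LDom 4 → Pt 4 → ℝ)
  (hm : letI := θ.instVβ₁; letI := θ.instVβ₂; letI := θ.instιβ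
    ∀ k (v : Fin (k + 1) → ℝ), v ∈ Box γ₀ k →
      betaMerged F (mergedTermFamilyMatT F N (TcanOfRecord F N) (chiFixed29 F N θ.ν θ.ε₂₉) θ.εbg) θ.ρ8 θ.bV k v =
        beta0OfMerged (betaMerged F (mergedTermFamilyMatT F N (TcanOfRecord F N) (chiFixed29 F N θ.ν θ.ε₂₉) θ.εbg) θ.ρ8 θ.bV) θ.v₀ k +
          B12Beta.secondMoment (fun _ _ => limKernel (A1 k v)) μ ν)
  -- N10's in-edge in the FAMILY currency at every run and the member letters law on the box, AT THE STAGE-12 PART (letters of record `c13OfRecord₁₂ θ.toStage12Params c₀`)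
  (hcF : ∀ P k v, v ∈ Box γ₀ k → (lamF P k v).c = c13OfRecord₁₂ F N θ.toStage12Params c₀)
  (hleafF : ∀ P, B13FamLeafOfRecord₁₂ F N θ.toStage12Params c₀ lamF P)
  -- per (scale, history) IN THE BOX: a run sequence whose families' members AT THAT HISTORY have growing coarse tori, their laws and restriction sentences
  (Ps : (k : ℕ) → (Fin (k + 1) → ℝ) → ℕ → B12.RunParams)
  (hn : ∀ k v, v ∈ Box γ₀ k → Tendsto (fun m => (lamF (Ps k v m) k v).n) atTop atTop)
  (hsp : ∀ k v, v ∈ Box γ₀ k → ∀ m, SpLaw (lamF (Ps k v m) k v)) (h213 : ∀ k v, v ∈ Box γ₀ k → ∀ m, Law213 (lamF (Ps k v m) k v))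
  (hR : ∀ k v, v ∈ Box γ₀ k → ∀ m, (lamF (Ps k v m) k v).Restr)
  -- N1 ∕ N3 at the letters of record and ℓ = ½L
  (hC : CondsL 4 (c13OfRecord₁₂ F N θ.toStage12Params c₀) (((c13OfRecord₁₂ F N θ.toStage12Params c₀).L : ℝ) / 2))
  (hs : SignsL (c13OfRecord₁₂ F N θ.toStage12Params c₀) α₂ q.B₃)
  -- the (4.4) seams with holomorphic activities, the (190) data, the (1.7) ∕ test-vector-limit data with the read-out of the leaf kernels (on the box)
  (Wn : (k : ℕ) → (Fin (k + 1) → ℝ) → ℕ → Type) (instW : ∀ k v m, NormedAddCommGroup (Wn k v m))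
  (instWs : ∀ k v m, NormedSpace ℂ (Wn k v m))
  (emb : (k : ℕ) → (v : Fin (k + 1) → ℝ) → (m : ℕ) → TDom 4 ((lamF (Ps k v m) k v).n + 1) → Wn k v m → (lamF (Ps k v m) k v).Φ)
  (hemb : ∀ k v, v ∈ Box γ₀ k → ∀ m X, ∀ u ∈ ball (0 : Wn k v m) α₂, emb k v m X u ∈ (lamF (Ps k v m) k v).sp2 X)
  (hH : ∀ k v, v ∈ Box γ₀ k → ∀ m (X Z : TDom 4 ((lamF (Ps k v m) k v).n + 1)), Z.1 ⊆ X.1 →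
    DifferentiableOn ℂ (fun u => (lamF (Ps k v m) k v).H Z (emb k v m X u)) (ball 0 α₂))
  (D : (k : ℕ) → (v : Fin (k + 1) → ℝ) → Data190 4 M (NOfLayers fun m => lamF (Ps k v m) k v) (Wn k v) q)
  (V : (k : ℕ) → (Fin (k + 1) → ℝ) → LDom 4 → Type) (instV : ∀ k v Y, NormedAddCommGroup (V k v Y))
  (instVs : ∀ k v Y, NormedSpace ℂ (V k v Y))
  (Fw : (k : ℕ) → (v : Fin (k + 1) → ℝ) → (Y : LDom 4) → V k v Y → ℂ)
  (hFd : ∀ k v, v ∈ Box γ₀ k → ∀ Y, ∃ ρ > 0, DifferentiableOn ℂ (Fw k v Y) (ball 0 ρ))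
  (r : (k : ℕ) → (v : Fin (k + 1) → ℝ) → (m : ℕ) → (Y : LDom 4) → Wn k v m →L[ℂ] V k v Y)
  (hfac : ∀ k v, v ∈ Box γ₀ k → ∀ Y : LDom 4, ∀ᶠ m in atTop, ∀ u ∈ ball (0 : Wn k v m) α₂,
    (lamF (Ps k v m) k v).Ek1 (tproj ((lamF (Ps k v m) k v).n + 1) Y) (emb k v m (tproj ((lamF (Ps k v m) k v).n + 1) Y) u) =
      Fw k v Y (r k v m Y u))
  (t : (k : ℕ) → (v : Fin (k + 1) → ℝ) → (Y : LDom 4) → Pt 4 → V k v Y)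
  (hconv : ∀ k v, v ∈ Box γ₀ k → ∀ (Y : LDom 4) (x : Pt 4),
    Tendsto (fun m => r k v m Y ((D k v).hn m (tproj ((lamF (Ps k v m) k v).n + 1) Y) (proj (((lamF (Ps k v m) k v).n + 1) * M) x)))
      atTop (𝓝 (t k v Y x)))
  (ha : ∀ k v, v ∈ Box γ₀ k → ∀ (Y : LDom 4) (z : Pt 4), A1 k v Y z = (mixedDeriv (Fw k v Y) (t k v Y 0) (t k v Y z)).re)

include hle hm hcF hleafF hn hsp h213 hR hC hs instW instWs hemb hH hFd hfac hconv ha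

/-- **THE (D4)-CHAIN INSTANCE AT THE STAGE-13 SPLIT FROM A STAGE-12 [B13] FAMILY OF RECORD, RUN SEQUENCES AT FIXED HISTORY** (p478229's `exists_chainTFac190H_view_of_family`
re-keyed: the (1.22) identification `hm` at the ₁₃ merged β, `beta1_eq` by the generic merged-split algebra; the leaves by the row-(D4) owner's `polLeavesTFac190H_ofRecordB13`
over the members `m ↦ lamF (Ps k v m) k v` with the letters of record of `θ.toStage12Params`): `∃ R : ChainTFac190H 4 M μ ν (split₁₃) γ₀ (c13OfRecord₁₂ θ₁₂ c₀) (L∕2) α₂ q`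
with the HANDLES `R.A1 = A1`, `(R.leaves k v hv).N = m ↦ n_m + 1`, `(R.leaves k v hv).W ≍ m ↦ (WtOfRecord θ₃ (lamF (Ps k v m) k v)).toTorusStep`.  Instance 0∕1.
[cite: Balaban1987RG1, Thm 3 p.264, (1.7) p.261, (1.21)-(1.22) p.264, (2.9) p.266 and (4.4) p.281; Balaban1988RG2Cluster, (2.13) p.14, p.15, Lemma 3 (2.38) p.20 and p.21; Balaban1985Variational, (190) p.308] -/
theorem exists_chainTFac190H_betaOfRecord₁₃_of_family :
    letI := θ.instVβ₁; letI := θ.instVβ₂; letI := θ.instιβ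
    ∃ R : ChainTFac190H 4 M μ ν
        (oneLoopSplit_betaOfMerged (betaMerged F (mergedTermFamilyMatT F N (TcanOfRecord F N) (chiFixed29 F N θ.ν θ.ε₂₉) θ.εbg) θ.ρ8 θ.bV)
          (beta0OfMerged (betaMerged F (mergedTermFamilyMatT F N (TcanOfRecord F N) (chiFixed29 F N θ.ν θ.ε₂₉) θ.εbg) θ.ρ8 θ.bV) θ.v₀) θ.γ)
        γ₀ (c13OfRecord₁₂ F N θ.toStage12Params c₀) (((c13OfRecord₁₂ F N θ.toStage12Params c₀).L : ℝ) / 2) α₂ q,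
      R.A1 = A1 ∧ ∀ k (v : Fin (k + 1) → ℝ) (hv : v ∈ B12Beta.HistBox γ₀ k),
        (R.leaves k v hv).N = (fun m => (lamF (Ps k v m) k v).n + 1) ∧
          HEq (R.leaves k v hv).W (fun m => (WtOfRecord θ.toStage3Params (lamF (Ps k v m) k v)).toTorusStep) := by
  letI := θ.instVβ₁; letI := θ.instVβ₂; letI := θ.instιβ
  refine ⟨{ A1 := A1
            beta1_eq := beta1_eq_oneLoopSplit_betaOfMerged_of_merged _ _ hle A1 hm
            leaves := fun k v hv =>
              haveI hv' : v ∈ Box γ₀ k := (histBox_eq_box γ₀ k) ▸ hv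
              polLeavesTFac190H_ofRecordB13 (fun m => lamF (Ps k v m) k v) (hn k v hv') (c13OfRecord₁₂ F N θ.toStage12Params c₀) α₂ q
                (fun m => c13OfRecord_member_of_family F N hcF hv' (Ps k v m)) (hsp k v hv') (h213 k v hv')
                (fun m => b13LeafOfRecord_member_of_family F N hle hcF hleafF hv' (Ps k v m)) (hR k v hv') hC hs.A (Wn k v)
                (instW := instW k v) (instWs := instWs k v) (emb k v) (hemb k v hv') (hH k v hv') (D k v) (V k v)
                (instV := instV k v) (instVs := instVs k v) (Fw k v) (hFd k v hv') (r k v) (hfac k v hv') (t k v)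
                (hconv k v hv') (A1 k v) (ha k v hv') }, rfl, fun k v hv => ⟨rfl, HEq.rfl⟩⟩

/-- **THE ROWS-(D4) ∧ B4 RESIDUE AT THE STAGE-13 SPLIT FROM THE FAMILY** (the shape a ₁₃ crux stub pinned on `(TcanOfRecord, chiFixed29)` would read): the family list, the
(1.22) identification at the ₁₃ merged β, N1 ∕ N3 at the letters of record (`CondsL`, `Valid`, `SignsL`; N2's R22 an identity of the letters, `r22gen_half_c13OfRecord₁₂`), the
one-loop smallness `ε₁·K_rem,L ≤ s` and (C-leaf) in the (1.7) read-out letters ⟹ `AtSlopeCont (split₁₃) γ₀ s` (p472048's `atSlopeCont_of_chainTFac190H_leafwise`).  A REDUCTION —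
instance 0∕1. [cite: Balaban1988RG2Cluster, Lemma 3 (2.38) p.20 and p.21; Balaban1987RG1, (1.7) p.261, (1.20)-(1.22) p.264, (2.9) p.266 and (5.1) p.292; Balaban1985Variational, (190) p.308] -/
theorem atSlopeCont_betaOfRecord₁₃_of_family_leafwise (hq : q.Valid (c13OfRecord₁₂ F N θ.toStage12Params c₀).δ₀) {s : ℝ}
    (hsmall : (c13OfRecord₁₂ F N θ.toStage12Params c₀).ε₁ * remCoeffL 4 M (c13OfRecord₁₂ F N θ.toStage12Params c₀) α₂ q.B₃ ≤ s)
    (hcont : ∀ k (Y : LDom 4) (z : Pt 4),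
      ContinuousOn (fun v : Fin (k + 1) → ℝ => (mixedDeriv (Fw k v Y) (t k v Y 0) (t k v Y z)).re) (Box γ₀ k)) :
    letI := θ.instVβ₁; letI := θ.instVβ₂; letI := θ.instιβ
    AtSlopeCont
      (oneLoopSplit_betaOfMerged (betaMerged F (mergedTermFamilyMatT F N (TcanOfRecord F N) (chiFixed29 F N θ.ν θ.ε₂₉) θ.εbg) θ.ρ8 θ.bV)
          (beta0OfMerged (betaMerged F (mergedTermFamilyMatT F N (TcanOfRecord F N) (chiFixed29 F N θ.ν θ.ε₂₉) θ.εbg) θ.ρ8 θ.bV) θ.v₀) θ.γ)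
      γ₀ s := by
  letI := θ.instVβ₁; letI := θ.instVβ₂; letI := θ.instιβ
  obtain ⟨R, hA1, -⟩ := exists_chainTFac190H_betaOfRecord₁₃_of_family F N θ c₀ lamF hle A1 hm hcF hleafF Ps hn hsp h213 hR hC hs Wn instW
    instWs emb hemb hH D V instV instVs Fw hFd r hfac t hconv ha
  subst hA1
  exact atSlopeCont_of_chainTFac190H_leafwise R hC (r22gen_half_c13OfRecord₁₂ F N θ.toStage12Params c₀) hq hs hsmall
    fun k Y z => (hcont k Y z).congr fun v hv => ha k v hv Y z

/-- **B4 ON THE BOX AT THE STAGE-13 β FROM THE FAMILY + (C-pt)** (`Gaps.BetaContFromD4Chain.betaContH_of_chainTFac190H` at the instance; the split's β IS `betaOfRecord₁₃ θ`, `rfl`).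
Instance 0∕1. [cite: Balaban1987RG1, (1.7) p.261, (1.20)-(1.22) p.264, (2.9) p.266 and (5.10) p.293; Balaban1988RG2Cluster, Lemma 3 (2.38) p.20 and p.21; Balaban1985Variational, (190) p.308] -/
theorem betaContH_betaOfRecord₁₃_of_family (hq : q.Valid (c13OfRecord₁₂ F N θ.toStage12Params c₀).δ₀)
    (hcpt : ∀ k (x : Pt 4), ContinuousOn (fun v : Fin (k + 1) → ℝ => limKernel (A1 k v) x) (Box γ₀ k)) :
    BetaContH γ₀ (betaOfRecord₁₃ F N θ) := by
  letI := θ.instVβ₁; letI := θ.instVβ₂; letI := θ.instιβ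
  obtain ⟨R, hA1, -⟩ := exists_chainTFac190H_betaOfRecord₁₃_of_family F N θ c₀ lamF hle A1 hm hcF hleafF Ps hn hsp h213 hR hC hs Wn instW
    instWs emb hemb hH D V instV instVs Fw hFd r hfac t hconv ha
  subst hA1
  exact betaContH_of_chainTFac190H R hC (r22gen_half_c13OfRecord₁₂ F N θ.toStage12Params c₀) hq hs (by norm_num) hcpt

/-- **N26 AT THE STAGE-13 DATUM FROM THE FAMILY + (C-pt)** on a box `0 < γ₀ ≤ θ.γ` (`βfun_datumOfRecord₁₃`, `rfl`).  Instance 0∕1; N26 NOT discharged.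
[cite: Balaban1987RG1, (1.7) p.261, (1.20)-(1.22) p.264, (2.9) p.266, (4.4) p.281 and (5.10) p.293; Balaban1988RG2Cluster, p.15, Lemma 3 (2.38) p.20 and p.21; Balaban1985Variational, (190) p.308] -/
theorem n26_datumOfRecord₁₃_of_family (hP : θ.Provisos₁₃ F N) (hq : q.Valid (c13OfRecord₁₂ F N θ.toStage12Params c₀).δ₀)
    (hcpt : ∀ k (x : Pt 4), ContinuousOn (fun v : Fin (k + 1) → ℝ => limKernel (A1 k v) x) (Box γ₀ k)) (hγ₀ : 0 < γ₀) :
    ∃ γc : ℝ, 0 < γc ∧ BetaContH γc (datumOfRecord₁₃ F N θ hP).βfun :=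
  ⟨γ₀, hγ₀, betaContH_betaOfRecord₁₃_of_family F N θ c₀ lamF hle A1 hm hcF hleafF Ps hn hsp h213 hR hC hs Wn instW instWs emb hemb hH D V
    instV instVs Fw hFd r hfac t hconv ha hq hcpt⟩

end Family13

/-! ## §2 Record level over `IsRecordOfRecord₁₃C`: N26, and N25's END ∧ N26, per admissible presentation on the world's window -/

section Route

/-- **N26 AT A STAGE-13 RECORD `(D, w)` FROM THE RESIDUE ON THE WORLD's OWN WINDOW**: if every admissible Stage-13 presentation `θ` (with provisos) of `D` with `w.γ ≤ θ.γ`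
carries, at SOME split of `D`'s β and SOME slope, `AtSlopeCont Sβ w.γ s`, then `∃ γc > 0, BetaContH γc D.βfun` (`γc := w.γ`).  Instance 0∕1; N26 NOT discharged.
[cite: Balaban1987RG1, (1.20)-(1.22) p.264; Balaban1988RG2Cluster, Lemma 3 (2.38) p.20; Balaban1989LargeFieldII, Thm 1 p.355 (the record)] -/
theorem n26_of_isRecordOfRecord₁₃C_of_atSlopeCont {D : FiniteEpsData F (Matrix.specialUnitaryGroup (Fin N) ℂ)} {w : WorldP}
    (h : IsRecordOfRecord₁₃C F N D w)
    (hin : ∀ (θ : Stage13Params F N) (hP : θ.Provisos₁₃ F N), θ.Admissible F N → D = datumOfRecord₁₃ F N θ hP → w.γ ≤ θ.γ →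
      ∃ (Sβ : B12Beta.OneLoopSplit D.βfun) (s : ℝ), AtSlopeCont Sβ w.γ s) :
    ∃ γc : ℝ, 0 < γc ∧ BetaContH γc D.βfun := by
  obtain ⟨θ, hP, hθ, hD, -, ⟨hγ0, hγle⟩, -, -⟩ := h
  obtain ⟨Sβ, s, hs⟩ := hin θ hP hθ hD hγle
  exact ⟨w.γ, hγ0, betaContH_of_atSlopeCont hs⟩

/-- **N25's END ∧ N26 AT A STAGE-13 RECORD `(D, w)`, predicate form, residue currency** (the (D1) + rows-(D4) ∧ B4 package per admissible presentation, on the world's window,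
at the one-loop slope).  Instance 0∕1; N25 ∕ N26 NOT discharged. [cite: Balaban1987RG1, Thm 2 p.259 (first sentence) and (1.20)-(1.22) p.264; Balaban1988RG2Cluster, Lemma 3 (2.38) p.20; Balaban1989LargeFieldII, Thm 1 p.355] -/
theorem endpoint_and_n26_of_isRecordOfRecord₁₃C_of_residue_atSlopeCont {D : FiniteEpsData F (Matrix.specialUnitaryGroup (Fin N) ℂ)} {w : WorldP}
    (h : IsRecordOfRecord₁₃C F N D w)
    (hin : ∀ (θ : Stage13Params F N) (hP : θ.Provisos₁₃ F N), θ.Admissible F N → D = datumOfRecord₁₃ F N θ hP → w.γ ≤ θ.γ →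
      ∃ (Sβ : B12Beta.OneLoopSplit D.βfun) (Lc : ℕ) (_ : NeZero Lc) (Js : ℕ → JetData 3 Lc) (Nc : ℝ) (μ ν : Fin 4),
        (∀ j, Sβ.β0 j = B12Beta.secondMoment (TbalOf Lc Js j) μ ν) ∧ D1Residue.Residue Lc Js Nc μ ν ∧
        AtSlopeCont Sβ w.γ (B12Normalization.stepBal Nc Lc)) :
    EndpointExistence D.C.toB12 ∧ ∃ γc : ℝ, 0 < γc ∧ BetaContH γc D.βfun := by
  obtain ⟨θ, hP, hθ, hD, -, ⟨hγ0, hγle⟩, -, -⟩ := h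
  obtain ⟨Sβ, Lc, _, Js, Nc, μ, ν, hβ, h1, hres⟩ := hin θ hP hθ hD hγle
  subst hD
  exact endpoint_and_n26_datumOfRecord₁₃_of_residue_atSlopeCont F N θ hP Sβ Js hβ h1 hγ0 hres

end Route

/-! ## §3 N1 AT THE FAITHFUL STAGE-13 LETTERS (`ε₁ := θ.ε₂₉`, the (2.9) letter the ₁₃ χ reads; [I] (2.9) and [II] (1.20) ∕ (2.3) print ONE `ε₁`): κ rows as at ₁₂, SMALL ROW a RECORD inequality -/

section Faithful

variable (θ : Stage13Params F N) (c₀ : B13.Consts)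

/-- **The faithful Stage-13 letters are the ₁₂ carrier at a residual whose `ε₁` IS the record's** (`rfl`: `c13OfRecord₁₂` overrides only `L`, `δ`, `γ`, `E₀`, `κ`), so every ₁₂-keyed
theorem of this seat's lineage (p478229, p479720, p485881, §1b here) applies at them BY NAME with `c₀ := { c₀ with ε₁ := θ.ε₂₉ }`. [cite: Balaban1987RG1, (2.9) p.266; Balaban1988RG2Cluster, (1.20) p.6 and (2.3) p.12 (one threshold ε₁)] -/
theorem c13OfRecord₁₂_faithful_eq :
    c13OfRecord₁₂ F N θ.toStage12Params { c₀ with ε₁ := θ.ε₂₉ } = { c13OfRecord₁₂ F N θ.toStage12Params c₀ with ε₁ := θ.ε₂₉ } := rfl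

/-- **N1 AT THE FAITHFUL STAGE-13 LETTERS FROM THE κ THRESHOLD: THE RECORD's κ–ε₁ SMALL ROW and the residual O(1) of (2.41)** — `Stage13Params` carries `s2.lf.κ`, `ℓ₆`, `E₀` through
`toStage12Params`, so `20·(64·log 162 + 1) ≤ θ.s2.lf.κ` pays both κ rows (p485881 `condsL_c13OfRecord₁₂_half_iff_of_kappa_ge`); what is left is
`C₃·θ.ε₂₉·e^{5κ+1}·K₀(64,8)·9·64 ≤ 1` — print's coupling of the (2.9) threshold to the (I.1.18) rate ([II] p.7 «if e^{32κ₁}ε₁ is smaller than an absolute constant», p.21 «ε₁ sufficiently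
small»), a condition ON THE RECORD's two numerals (`C₃ = 2(L+2)⁴·A₁·(E₀·K₀(c₀))`) — and `e·576·K₀(64,8)² ≤ c₀.A₂` (residual).  This is the row a ₁₃ witness must honour when it pins `ε₁`
(dag-ref-D ⚑ EPS-PIN; this seat's LOCATED-N26-EPS1). [cite: Balaban1988RG2Cluster, p.7 (after (1.21)), p.21 (after (2.39) and after (2.41)); Balaban1987RG1, (1.18) p.263 and (2.9) p.266] -/
theorem condsL_faithful_stage13_iff_of_kappa_ge (hκ : 20 * (64 * Real.log 162 + 1) ≤ θ.s2.lf.κ) :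
    CondsL 4 (c13OfRecord₁₂ F N θ.toStage12Params { c₀ with ε₁ := θ.ε₂₉ })
        (((c13OfRecord₁₂ F N θ.toStage12Params { c₀ with ε₁ := θ.ε₂₉ }).L : ℝ) / 2) ↔
      (c13OfRecord₁₂ F N θ.toStage12Params c₀).C3act * θ.ε₂₉ * Real.exp (5 * θ.s2.lf.κ + 1) * K₀ 64 8 * 9 * 64 ≤ 1 ∧
        Real.exp 1 * 9 * 64 * K₀ 64 8 ^ 2 ≤ c₀.A₂ :=
  condsL_c13OfRecord₁₂_half_iff_of_kappa_ge F N θ.toStage12Params { c₀ with ε₁ := θ.ε₂₉ } hκ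

/-- **THE INEQUALITY A STAGE-13 WITNESS's `ε₁` MUST MEET for N1 at the faithful letters** (when Lemma 3's activity constant is positive): `θ.ε₂₉ ≤ 1 ∕ (C₃·e^{5κ+1}·K₀(64,8)·576)` —
at the family numerics (κ = 2·10⁴, E₀ = 1, L = 3: `C₃ = 1250·A₁·K₀(c₀)`) an `e^{−100001}`-class threshold (p485881 `small_c13OfRecord₁₂_iff_eps_le` at the faithful residual).
[cite: Balaban1988RG2Cluster, p.7 (after (1.21)) and p.21 (after (2.39)); Balaban1987RG1, (2.9) p.266] -/
theorem small_faithful_stage13_iff_eps_le (hP : 0 < (c13OfRecord₁₂ F N θ.toStage12Params c₀).C3act) :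
    (c13OfRecord₁₂ F N θ.toStage12Params c₀).C3act * θ.ε₂₉ * Real.exp (5 * θ.s2.lf.κ + 1) * K₀ 64 8 * 9 * 64 ≤ 1 ↔
      θ.ε₂₉ ≤ 1 / ((c13OfRecord₁₂ F N θ.toStage12Params c₀).C3act * Real.exp (5 * θ.s2.lf.κ + 1) * K₀ 64 8 * 9 * 64) :=
  small_c13OfRecord₁₂_iff_eps_le F N θ.toStage12Params { c₀ with ε₁ := θ.ε₂₉ } hP

end Faithful

end Summit.QuantumFields.YangMills.Theorems.BalabanUVNodesN26AtRecord13

end
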